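import Summits.Ventures.CertifiedArithmetic.LowPrec.SRTwoSumExactLaw
import Summits.Ventures.CertifiedArithmetic.LowPrec.SRFast2Sum
import HarnessLib

/-!
# Fast2Sum under SR obeys the same range law as 2Sum (file XLV)

HONEST FRAMING: certified error envelopes and provably optimal rounding/accumulation schemes for
low-precision formats under stated cost models; every table by two implementations; no hardware or
vendor claims.

Dekker's Fast2Sum `s = ∘(a + b); z = ∘(s − a); t = ∘(b − z)` executed with all three operations
independently and saturating-stochastically rounded into the value set `F_φ` of a minifloat format,
on ordered data `|b| ≤ |a|` (file XXVIII `SRFast2Sum`: the second operation is exact surely, the pair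
is exactly unbiased, and `P(s + t = a + b)` is the SR-average of the indicator `a + b − s ∈ F_φ`).

**THE RANGE LAW.** `P(s + t = a + b) = 1` for ALL ordered data iff `maxScaled ≤ 4^(m+1)` — the same
criterion as for the six-operation 2Sum (file XLIV `twoSumE_exact_iff`):
* `fast2SumE_exact_of_small`: if `maxScaled ≤ 4^(m+1)` then every faithful rounding error of an
  addition is a value (`err_mem_of_small`, file XLIII a), so Fast2Sum-SR is surely exact;
* `fast2SumE_witness`: otherwise `maxScaled ≥ 4^(m+1) + 2^(m+2)` and `a = 4^(m+1)·q`, `b = q` has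
  `P(s + t = a + b) = 1 − 2^−(m+2)` exactly (on the up-branch the error `−(2^(m+2) − 1)·q` is odd
  and too large to be a value);
* `fast2SumE_exact_iff`, `eft_exact_iff_twoSum`: the two EFTs are surely exact on exactly the same
  formats; E3M2 witness `(4, 1/16)` with `P = 15/16` (= row 1446 of the two-implementation
  certificate `certs/sr/gen7/eft/F2S_e3m2_{A,B}`).

References: Dekker 1971; [BoldoGraillatMuller2017, Thm 3.1] (Fast2Sum with faithful roundings,
deterministic, no overflow); [ConnollyHighamMary2021] (the SR model). The probability-one range
criterion under saturating SR: new (see `FRESHNESS-SR.md`, VERDICT C).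
-/

namespace Summit.Ventures.CertifiedArithmetic.LowPrec.SR

open Literature.ComputerArithmetic.ConnollyHighamMary2021
open Literature.ComputerArithmetic.FloatingPoint
open Finset MiniFloat

section Formats

variable {φ : Format}

/-- **Fast2Sum under SR is surely exact when `maxScaled ≤ 4^(m+1)`**, for all ordered data. -/
theorem fast2SumE_exact_of_small (hM : φ.maxScaled ≤ 4 ^ (φ.manBits + 1)) (a b : MiniFloat φ)
    (hab : |b.toRat| ≤ |a.toRat|) :
    fast2SumE (valueSet φ) a.toRat b.toRat
      (fun s t => if s + t = a.toRat + b.toRat then 1 else 0) = 1 :=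
  fast2SumE_exact_of_mem a b hab
    (err_mem_of_small hM a b (dn_faithful (valueSet_nonempty φ) _))
    (err_mem_of_small hM a b (up_faithful (valueSet_nonempty φ) _))

/-- **THE WITNESS**: if `maxScaled ≥ 4^(m+1) + 2^(m+2)` then `a = 4^(m+1)·q`, `b = q` (ordered data)
has `P(s + t = a + b) = 1 − 2^−(m+2)` under Fast2Sum-SR. -/
theorem fast2SumE_witness (hbig : 4 ^ (φ.manBits + 1) + 2 ^ (φ.manBits + 2) ≤ φ.maxScaled) :
    ∃ a b : MiniFloat φ, a.toRat = 4 ^ (φ.manBits + 1) * φ.quantum ∧ b.toRat = φ.quantum ∧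
      |b.toRat| ≤ |a.toRat| ∧
      fast2SumE (valueSet φ) a.toRat b.toRat
        (fun s t => if s + t = a.toRat + b.toRat then 1 else 0) = 1 - 1 / 2 ^ (φ.manBits + 2) := by
  have hq := φ.quantum_pos
  obtain ⟨P, hP⟩ : ∃ P : ℕ, P = 2 ^ (φ.manBits + 2) := ⟨_, rfl⟩
  obtain ⟨Q, hQ⟩ : ∃ Q : ℕ, Q = 4 ^ (φ.manBits + 1) := ⟨_, rfl⟩
  have hQP : Q = P * 2 ^ φ.manBits := by
    rw [hP, hQ, show (4 : ℕ) = 2 ^ 2 by norm_num, ← pow_mul, ← pow_add]; congr 1; ring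
  have h8 : 2 ^ (φ.manBits + 1 + (φ.manBits + 2)) = 2 * Q := by
    rw [hQ, show (4 : ℕ) = 2 ^ 2 by norm_num, ← pow_mul, ← pow_succ']; congr 1; ring
  have h2P : 2 ≤ P := by
    rw [hP, pow_succ]; have := Nat.one_le_two_pow (n := φ.manBits + 1); omega
  have hPQ : P ≤ Q := by rw [hQP]; exact Nat.le_mul_of_pos_right _ (Nat.one_le_two_pow)
  rw [← hP, ← hQ] at hbig
  have hQq : (4 : ℚ) ^ (φ.manBits + 1) = Q := by rw [hQ]; push_cast; ring
  have hPq : (2 : ℚ) ^ (φ.manBits + 2) = P := by rw [hP]; push_cast; ring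
  rw [hQq, hPq]
  have hdP : 2 ^ (φ.manBits + 2) ∣ P := by rw [hP]
  have hdQ : 2 ^ (φ.manBits + 2) ∣ Q := ⟨2 ^ φ.manBits, by rw [hQP, hP]⟩
  have vQ : (Q : ℚ) * φ.quantum ∈ valueSet φ :=
    natMul_mem_of_representable (representable_of_pow_dvd hdQ (by omega) (by omega))
  have vU : ((Q + P : ℕ) : ℚ) * φ.quantum ∈ valueSet φ :=
    natMul_mem_of_representable (representable_of_pow_dvd (dvd_add hdQ hdP) (by omega) hbig)
  have v1 : φ.quantum ∈ valueSet φ := by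
    have h := intMul_mem_of_natAbs_le_pow (φ := φ) (N := 1) (by simp [Nat.one_le_two_pow])
      (by simp; omega)
    simpa using h
  have nE : -((P : ℚ) - 1) * φ.quantum ∉ valueSet φ := by
    have h := neg_pred_pow_notMem φ; rwa [← hP] at h
  obtain ⟨a, ha⟩ := mem_valueSet.mp vQ
  obtain ⟨b, hb⟩ := mem_valueSet.mp v1
  have hQ1 : (1 : ℚ) ≤ Q := by exact_mod_cast (le_trans (by omega) (h2P.trans hPQ) : 1 ≤ Q)
  have hab : |b.toRat| ≤ |a.toRat| := by
    rw [ha, hb, abs_of_pos hq, abs_of_nonneg (by positivity)]; nlinarith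
  refine ⟨a, b, ha, hb, hab, ?_⟩
  rw [fast2SumE_exact_law a b hab, ha, hb]
  have hgap : ∀ y ∈ valueSet φ, y ≤ (Q : ℚ) * φ.quantum ∨ ((Q + P : ℕ) : ℚ) * φ.quantum ≤ y := by
    intro y hy
    obtain ⟨v, rfl⟩ := mem_valueSet.mp hy
    rcases le_or_gt v.toRat ((Q : ℚ) * φ.quantum) with h | h
    · exact Or.inl h
    · right
      have hv0 : 0 ≤ v.toRat := le_trans (by positivity) h.le
      rw [toRat_eq_toInt_mul, toInt_eq_scaledMag_of_nonneg hv0] at h ⊢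
      push_cast at h ⊢
      have h' : (Q : ℚ) < v.scaledMag := lt_of_mul_lt_mul_right h hq.le
      have hle := le_of_representable_gt (representable_scaledMag v)
        (by rw [← hQ]; exact_mod_cast h')
      rw [← hP, ← hQ] at hle
      exact mul_le_mul_of_nonneg_right (by exact_mod_cast hle) hq.le
  obtain ⟨-, hdn, hup, hp⟩ := LimitedBits.candidates_of_gap vQ vU hgap
    (x := (Q : ℚ) * φ.quantum + φ.quantum) (by linarith)
    (by push_cast; have : (2 : ℚ) ≤ P := by exact_mod_cast h2P
        nlinarith)
  rw [step_apply (valueSet φ) ((Q : ℚ) * φ.quantum + φ.quantum), hdn, hup, hp,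
    show (Q : ℚ) * φ.quantum + φ.quantum - ((Q + P : ℕ) : ℚ) * φ.quantum
      = -((P : ℚ) - 1) * φ.quantum by push_cast; ring, if_neg nE,
    show (Q : ℚ) * φ.quantum + φ.quantum - (Q : ℚ) * φ.quantum = φ.quantum by ring, if_pos v1,
    mul_zero, zero_add, mul_one,
    show ((Q + P : ℕ) : ℚ) * φ.quantum - (Q : ℚ) * φ.quantum = (P : ℚ) * φ.quantum by
      push_cast; ring,
    div_mul_cancel_right₀ hq.ne', one_div]

/-- **THE FAST2SUM-UNDER-SR EXACTNESS LAW**: surely exact for all ordered data iff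
`maxScaled ≤ 4^(m+1)`. -/
theorem fast2SumE_exact_iff (φ : Format) :
    (∀ a b : MiniFloat φ, |b.toRat| ≤ |a.toRat| → fast2SumE (valueSet φ) a.toRat b.toRat
        (fun s t => if s + t = a.toRat + b.toRat then 1 else 0) = 1) ↔
      φ.maxScaled ≤ 4 ^ (φ.manBits + 1) := by
  refine ⟨fun h => ?_, fun hM a b hab => fast2SumE_exact_of_small hM a b hab⟩
  rcases maxScaled_dichotomy φ with hM | hbig
  · exact hM
  · exfalso
    obtain ⟨a, b, -, -, hab, h1⟩ := fast2SumE_witness hbig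
    have h2 := h a b hab
    rw [h1] at h2
    have h3 : (0 : ℚ) < 1 / 2 ^ (φ.manBits + 2) := by positivity
    linarith

/-- **THE TWO EFTs AGREE**: 2Sum-SR is surely exact for all data iff Fast2Sum-SR is surely exact
for all ordered data (both iff `maxScaled ≤ 4^(m+1)`). -/
theorem eft_exact_iff_twoSum (φ : Format) :
    (∀ a b : MiniFloat φ, |b.toRat| ≤ |a.toRat| → fast2SumE (valueSet φ) a.toRat b.toRat
        (fun s t => if s + t = a.toRat + b.toRat then 1 else 0) = 1) ↔
    (∀ a b : MiniFloat φ, twoSumE (valueSet φ) a.toRat b.toRat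
        (fun s t => if s + t = a.toRat + b.toRat then 1 else 0) = 1) :=
  (fast2SumE_exact_iff φ).trans (twoSumE_exact_iff φ).symm

/-! ### Named formats -/

/-- E2M1 and E2M3: Fast2Sum under SR is surely exact on all ordered pairs (structural proof of the
`pexact = 1` column of `certs/sr/gen7/eft/F2S_e2m1`, `F2S_e2m3`, both implementations). -/
theorem fast2SumE_exact_FP4_E2M3 :
    (∀ a b : MiniFloat Format.E2M1, |b.toRat| ≤ |a.toRat| →
      fast2SumE (valueSet Format.E2M1) a.toRat b.toRat
        (fun s t => if s + t = a.toRat + b.toRat then 1 else 0) = 1) ∧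
    (∀ a b : MiniFloat Format.E2M3, |b.toRat| ≤ |a.toRat| →
      fast2SumE (valueSet Format.E2M3) a.toRat b.toRat
        (fun s t => if s + t = a.toRat + b.toRat then 1 else 0) = 1) :=
  ⟨fun a b hab => fast2SumE_exact_of_small (by decide) a b hab,
   fun a b hab => fast2SumE_exact_of_small (by decide) a b hab⟩

/-- **E3M2: NOT surely exact** — structural witness `a = 4`, `b = 1/16`, `P(s + t = a + b) = 15/16`
(row 1446 of `F2S_e3m2_A ≡ F2S_e3m2_B`; the table's minimum is `9/16`, file XXVIII). -/
theorem fast2SumE_witness_E3M2 :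
    ∃ a b : MiniFloat Format.E3M2, a.toRat = 4 ∧ b.toRat = 1 / 16 ∧ |b.toRat| ≤ |a.toRat| ∧
      fast2SumE (valueSet Format.E3M2) a.toRat b.toRat
        (fun s t => if s + t = a.toRat + b.toRat then 1 else 0) = 15 / 16 := by
  obtain ⟨a, b, ha, hb, hab, h⟩ := fast2SumE_witness (φ := Format.E3M2) (by decide)
  refine ⟨a, b, ?_, ?_, hab, ?_⟩
  · rw [ha]; decide +kernel
  · rw [hb]; decide +kernel
  · rw [h]; decide +kernel

/-- E4M3 and E5M2 (OCP FP8): Fast2Sum under SR is NOT surely exact. -/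
theorem fast2SumE_not_sure_FP8 :
    (¬ ∀ a b : MiniFloat Format.E4M3, |b.toRat| ≤ |a.toRat| →
      fast2SumE (valueSet Format.E4M3) a.toRat b.toRat
        (fun s t => if s + t = a.toRat + b.toRat then 1 else 0) = 1) ∧
    (¬ ∀ a b : MiniFloat Format.E5M2, |b.toRat| ≤ |a.toRat| →
      fast2SumE (valueSet Format.E5M2) a.toRat b.toRat
        (fun s t => if s + t = a.toRat + b.toRat then 1 else 0) = 1) :=
  ⟨fun h => absurd ((fast2SumE_exact_iff _).mp h) (by decide),
   fun h => absurd ((fast2SumE_exact_iff _).mp h) (by decide)⟩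

end Formats

end Summit.Ventures.CertifiedArithmetic.LowPrec.SR
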